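import Mathlib
import HarnessLib
import Literature.Computability.AlgebraicComplexity.DivisionSLP
import Summits.MatrixMultiplication.MatrixMultiplication.Theses.CondensationDistance
import Summits.MatrixMultiplication.MatrixMultiplication.Theses.LongExchangeCondensation

/-!
# Rung `LongExchangeSound` specialises to its floor `CondensationSound` (forward witness, TRIBUNAL-FIT F3, in-tree)

Route `MatrixMultiplication/LongExchangeCondensation`.  The rung `LongExchangeSound` (arities `g i ≥ 1`) restricted to the
constant arity `g ≡ 1` is the floor `CondensationDistance.CondensationSound` on the nose: a floor-valid (octahedral)
derivation is rung-valid with `g i = 1`, and the weighted length `Σ_i (2·1+3)` is `5·l`.  This is the planner's BC5 witness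
`bc/LongExchangeSound_special.lean` (attached to stmt-MatrixMultiplication-20136 as evidence only; here published in-tree),
restated against the landed rung: `CondensationSound_of_LongExchangeSound : LongExchangeSound → CondensationSound` (the floor
itself is `Theorems.CondensationSound.CondensationSound_of`; the rung is `LongExchangeSound_of`).
Sources: BurgisserClausenShokrollahi1997 Def. (4.7); FallatJohnson2011 §1.2.
-/

set_option linter.dupNamespace false

namespace Summit.MatrixMultiplication.MatrixMultiplication.Theorems.LongExchangeSound

open scoped BigOperators
open Literature.Computability.AlgebraicComplexity (Derivable)
open Summit.MatrixMultiplication.MatrixMultiplication.Theses.CondensationDistance (CondensationSound)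
open Summit.MatrixMultiplication.MatrixMultiplication.Theses.LongExchangeCondensation (LongExchangeSound)

/-- **The rung specialises to the floor** (F3 witness): an octahedral derivation is a long-exchange derivation with all
arities `1`, of weighted length `Σ_i 5 = 5·l`. [cite: BurgisserClausenShokrollahi1997, Def. (4.7)] -/
theorem CondensationSound_of_LongExchangeSound : LongExchangeSound → CondensationSound := by
  intro hR n m' h l f hvalid htgt
  have hD := hR n m' h l f (fun _ => 1) (fun i => Or.inl ⟨rfl, hvalid i⟩) htgt
  refine hD.mono (le_of_eq ?_) subset_rfl subset_rfl
  simp [Finset.sum_const, Finset.card_univ, Fintype.card_fin, mul_comm]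

end Summit.MatrixMultiplication.MatrixMultiplication.Theorems.LongExchangeSound
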